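import Summits.BirchSwinnertonDyer.BirchSwinnertonDyer.Theorems.Rank1ResidualX1GoodEisenstein
import Literature.NumberTheory.EllipticCurves.Rank1Residual.EisensteinGoodComplementSplit
import HarnessLib

/-!
# The good-Eisenstein locus of BSD in rank `≤ 1`, split by provenance: what rests on Beilinson–Flach-free print, what rests on class X1, what rests on Castella–Grossi–Skinner 2025 alone

HONEST FRAMING (cell `b2b-bsdres`, run/shared/lean/b2b/bsd-rank1-residual/): the goal is to DELETE
the COMBINATION-SHAPED residual classes for ALL analytic-rank `≤ 1` curves over `ℚ` from PUBLISHED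
theorems only; the construction-shaped remainder is TYPED, not attempted; this is not "finishing BSD".
Summits-side companion (prover x1a gen 7, `--supports stmt-BirchSwinnertonDyer-15418`) of
`Literature/…/Rank1Residual/EisensteinGoodComplementSplit.lean` (p193418) and of the gen-6 file
`Rank1ResidualX1GoodEisenstein.lean` (`forall_bsdp_goodEisenstein_iff_bsdpOnClassX1`: granted the
PUBLISHED facts INCLUDING Castella–Grossi–Skinner 2025 Thm. D, the whole good-Eisenstein locus
`p > 2`, `r_an ≤ 1` satisfies `BSD(E,p)` iff the typed target `BSDpOnClassX1` holds).

SECOND-LEVEL AUDIT (HOME/b2b-bsdres-x1a/X1-CHAIN.md §15; referee R75.2): CGS 2025 Thm. D is a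
refereed theorem whose printed proof imports CGS Thm. 3.1.1 "proved in [BST]" (Burungale–Skinner–Tian,
preprint 2021) — flag `CGS25-BST-Thm311`, informational, on every consumer of the fact. This file
records what the locus looks like when that one fact is WITHHELD:

* `forall_bsdp_goodEisenstein_iff_bsdpOnClassX1_and_cgsOnlyLocus` — granted ONLY the
  Beilinson–Flach-free published facts (Greenberg–Vatsal 2000 Thm. 1.3, Greenberg LNM 1716 Thm. 4.1,
  Castella–Grossi–Lee–Skinner 2022 Thm. F, modularity, Gross–Zagier–Kolyvagin):
  (∀ good Eisenstein `p > 2`, `r_an ≤ 1`: `BSD(E,p)`) ⟺ `BSDpOnClassX1` ∧ (`BSD(E,p)` on the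
  CGS-ONLY LOCUS `¬anom(p) ∧ ((r_an = 0 ∧ ¬gvpar(p)) ∨ (r_an = 1 ∧ gvpar(p)))`). The second conjunct is
  exactly what CGS 2025 Thm. D contributes beyond Beilinson–Flach-free print
  (`bsdp_cgsOnlyLocus_of_thmD`), and with it the gen-6 iff is recovered
  (`forall_bsdp_goodEisenstein_iff_bsdpOnClassX1_of_thmD`).
* Census (class-pairs `(isogeny class, p)`, hub ecdata, `HOME/b2b-bsdres-x1a/gen7/c6census_*`;
  `N < 2·10⁴` ‖ `N < 5·10⁵`): BF-free part = C7 (`r = 0 ∧ gvpar`) 503 ‖ 6 411 + CGLS-F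
  (`¬anom ∧ r = 1 ∧ ¬gvpar`) 362 ‖ 4 284; CGS-only locus 628 ‖ 7 939 (rank 0 type A 263 ‖ 3 430, rank 1
  type B 365 ‖ 4 509); X1 1 774 ‖ 20 133. Pair by pair the CGS-only locus is Beilinson–Flach-free
  modulo one finite certificate (`Rank1Residual.bsdp_of_cgsOnlyLocus_of_certificate`: Wuthrich 2014
  Prop. 21 at rank 0 when `p ∤ #Ш_an(E)` — 261 of the 263 class-pairs `N < 2·10⁴` on curve #1 —, the
  Greenberg–Vatsal + Perrin-Riou–Schneider route at rank 1 modulo Schneider's certificate — all 365).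

No label is changed by this file (the referee rules; R75.2: records closed ONLY through CGS Thm. D are
"X + literal flag", the BF-free ones flag-free).

## References
* [CastellaGrossiLeeSkinner2022] Invent. Math. 227 (2022), Thm. F = Thm. 5.3.1.
* [CastellaGrossiSkinner2025] Math. Ann. 393 (2025), Thm. D; Thm. 3.1.1 (proof sentence, [BST] preprint).
* [GreenbergVatsal2000] Invent. Math. 142 (2000) Thm. (1.3); [GreenbergLNM1716] Thm. 4.1.
* [Wuthrich2014] Doc. Math. 19 (2014) Prop. 21; [Miller2011LMS] Def. 1.1.
* RESIDUAL-CASES.md §a.1 C6/C7, §a.2 X1; REFEREE.md R75.2/R75.3; X1-CHAIN.md §15.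
-/

noncomputable section

open scoped Classical

open WeierstrassCurve Literature.NumberTheory.EllipticCurves
  Literature.NumberTheory.EllipticCurves.ModularForms Literature.NumberTheory.EllipticCurves.Rank1Residual
  Summit.BirchSwinnertonDyer.BirchSwinnertonDyer.Theorems.Rank1ResidualX1Defs
  Summit.BirchSwinnertonDyer.BirchSwinnertonDyer.Theorems.Rank1ResidualX1GoodEisenstein

set_option linter.dupNamespace false
set_option autoImplicit false

namespace Summit.BirchSwinnertonDyer.BirchSwinnertonDyer.Theorems.Rank1ResidualX1GoodEisensteinSplit

/-- **The good-Eisenstein locus WITHOUT Castella–Grossi–Skinner 2025.** Granted only the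
Beilinson–Flach-free PUBLISHED named facts — Greenberg–Vatsal 2000 Thm. 1.3 (`hGV`), Greenberg LNM 1716
Thm. 4.1 (`hGr`), Castella–Grossi–Lee–Skinner 2022 Thm. F (`hF`), modularity (`hmod`, `hmodP`),
Gross–Zagier–Kolyvagin (`hGZK`) —: (for every globally minimal elliptic `W/ℚ` and every good prime
`p > 2` with `E[p]` reducible and `ord_{s=1} L(E,s) ≤ 1`, Miller's `BSD(E,p)`) holds IF AND ONLY IF
the typed target `BSDpOnClassX1` holds AND `BSD(E,p)` holds on the CGS-only locus
`¬anom(p) ∧ ((r_an = 0 ∧ ¬gvpar(p)) ∨ (r_an = 1 ∧ gvpar(p)))` — the non-anomalous rank-`0` type-A and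
rank-`1` type-B pairs, whose only printed closing theorem is CGS 2025 Thm. D. (⇒: specialise; ⇐: the
trichotomy `Rank1Residual.bsdp_or_classX1_or_cgsOnlyLocus`.)
[cite: CastellaGrossiLeeSkinner2022, Theorem F = Thm. 5.3.1] [cite: GreenbergVatsal2000, Thm. (1.3)]
[cite: GreenbergLNM1716, Thm. 4.1] [cite: Miller2011LMS, Def. 1.1] -/
theorem forall_bsdp_goodEisenstein_iff_bsdpOnClassX1_and_cgsOnlyLocus
    (hGV : GreenbergVatsal2000.thm13_charIdeal_eq_of_gvPar) (hGr : greenberg_charValue_rankZero)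
    (hF : CastellaGrossiLeeSkinner2022.thmF_padicValRat_bsd_rank_one)
    (hmod : hasEntireLFunction_rat) (hmodP : nonempty_modularParametrizationData)
    (hGZK : rank_eq_analyticRank_of_analyticRank_le_one) :
    (∀ (W : WeierstrassCurve ℚ) [W.IsElliptic] [W.IsGloballyMinimal] (p : ℕ) [Fact p.Prime],
      2 < p → Good W p → Red W p → W.analyticRank ≤ 1 → BSDp W p) ↔
    (BSDpOnClassX1 ∧
      ∀ (W : WeierstrassCurve ℚ) [W.IsElliptic] [W.IsGloballyMinimal] (p : ℕ) [Fact p.Prime],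
        2 < p → Good W p → Red W p → W.analyticRank ≤ 1 →
        (¬ Anom W p ∧ ((W.analyticRank = 0 ∧ ¬ GVPar W p) ∨ (W.analyticRank = 1 ∧ GVPar W p))) →
        BSDp W p) := by
  constructor
  · intro h
    refine ⟨fun W _ _ p _ hX hr => h W p hX.1 hX.2.2.1 hX.2.1 hr, ?_⟩
    intro W _ _ p _ hp hgood hred hr _
    exact h W p hp hgood hred hr
  · rintro ⟨hX1, hcgs⟩ W _ _ p _ hp hgood hred hr
    rcases bsdp_or_classX1_or_cgsOnlyLocus hGV hGr hF hmod hmodP hGZK W p hp hgood hred hr with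
      h | h | h
    · exact h
    · exact hX1 W p h hr
    · exact hcgs W p hp hgood hred hr h

/-- **What CGS 2025 Thm. D adds beyond Beilinson–Flach-free print, exactly:** the named fact
`CastellaGrossiSkinner2025.thmD_padicValRat_bsd_rank_le_one` (`hD`; PUBLISHED, Math. Ann. 393 (2025);
proof importing Thm. 3.1.1 "proved in [BST]", flag `CGS25-BST-Thm311`), with modularity and GZK,
discharges the CGS-only-locus conjunct of
`forall_bsdp_goodEisenstein_iff_bsdpOnClassX1_and_cgsOnlyLocus`.
[cite: CastellaGrossiSkinner2025, Theorem D] [cite: Miller2011LMS, Def. 1.1] -/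
theorem bsdp_cgsOnlyLocus_of_thmD (hD : CastellaGrossiSkinner2025.thmD_padicValRat_bsd_rank_le_one)
    (hmod : hasEntireLFunction_rat) (hGZK : rank_eq_analyticRank_of_analyticRank_le_one) :
    ∀ (W : WeierstrassCurve ℚ) [W.IsElliptic] [W.IsGloballyMinimal] (p : ℕ) [Fact p.Prime],
      2 < p → Good W p → Red W p → W.analyticRank ≤ 1 →
      (¬ Anom W p ∧ ((W.analyticRank = 0 ∧ ¬ GVPar W p) ∨ (W.analyticRank = 1 ∧ GVPar W p))) →
      BSDp W p :=
  fun W _ _ p _ hp hgood hred hr hloc => bsdp_of_cgsOnlyLocus hD hmod hGZK W p hp hgood hred hr hloc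

/-- **Re-assembly (consistency with gen 6):** adding CGS 2025 Thm. D (`hD`) to the Beilinson–Flach-free
facts recovers `Rank1ResidualX1GoodEisenstein.forall_bsdp_goodEisenstein_iff_bsdpOnClassX1`'s
statement — the good-Eisenstein locus in rank `≤ 1` satisfies `BSD(E,p)` iff `BSDpOnClassX1` — now
proved THROUGH the split, so that the kernel shows where the CGS fact is consumed (only on the
CGS-only locus). [cite: CastellaGrossiSkinner2025, Theorem D]
[cite: CastellaGrossiLeeSkinner2022, Theorem F = Thm. 5.3.1] [cite: GreenbergVatsal2000, Thm. (1.3)] -/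
theorem forall_bsdp_goodEisenstein_iff_bsdpOnClassX1_of_thmD
    (hD : CastellaGrossiSkinner2025.thmD_padicValRat_bsd_rank_le_one)
    (hGV : GreenbergVatsal2000.thm13_charIdeal_eq_of_gvPar) (hGr : greenberg_charValue_rankZero)
    (hF : CastellaGrossiLeeSkinner2022.thmF_padicValRat_bsd_rank_one)
    (hmod : hasEntireLFunction_rat) (hmodP : nonempty_modularParametrizationData)
    (hGZK : rank_eq_analyticRank_of_analyticRank_le_one) :
    (∀ (W : WeierstrassCurve ℚ) [W.IsElliptic] [W.IsGloballyMinimal] (p : ℕ) [Fact p.Prime],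
      2 < p → Good W p → Red W p → W.analyticRank ≤ 1 → BSDp W p) ↔ BSDpOnClassX1 := by
  rw [forall_bsdp_goodEisenstein_iff_bsdpOnClassX1_and_cgsOnlyLocus hGV hGr hF hmod hmodP hGZK]
  exact ⟨fun h => h.1, fun h => ⟨h, bsdp_cgsOnlyLocus_of_thmD hD hmod hGZK⟩⟩

end Summit.BirchSwinnertonDyer.BirchSwinnertonDyer.Theorems.Rank1ResidualX1GoodEisensteinSplit

end
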